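import Mathlib.Analysis.SpecialFunctions.Sqrt
import Summits.QuantumFields.BalabanUV.Beta.EriceFlowEnclosureWhitneyCalc

/-!
# Beta / EriceFlowEnclosureWhitneyWitness — THE CONSTANT `m!∕(2m)!` OF P2 #43's WHITNEY LEMMA IS SHARP: the even monomial `g^{2m}`
# attains it with equality at every point (`∂ᵍ_{2m} g^{2m} ≡ (2m)!`, `∂ˢ_m (√s)^{2m} = ∂ˢ_m s^m ≡ m!`), via the monomial towers within a
# closed interval
# (β-flow team, prover 2 = lower ∕ positivity side, unit `b2b-balaban-beta-bflow-p2`, gen 26; companion of P2 #43 `EriceFlowEnclosureWhitney`,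
# over P2 #43-A `contDiffOn_of_tower`)

HONEST FRAMING (page 1 of everything the β sub-cell writes): discharging `BetaPertH` makes Bałaban's UV stability UNCONDITIONAL — a
real constructive-QFT result; it is NOT the continuum limit and NOT the Clay problem.  HONEST DEPENDENCY (cell reorg 2026-08-19,
verbatim): «continuum YM on T⁴ ⇐ BetaPertH ∧ nine spine estimates (0/9 proved); BetaPertH ⇐ (D1) ∧ (D4) ∧ CAP+tail; G-an2-4 gates
asym, D1 and NE2/3/4.»  THIS MODULE DISCHARGES NOTHING of that: [folklore] calculus of monomials, a TOY witness with NO Erice letter.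
THE POINT.  P2 #43 `whitney_even` bounds the m-th derivative in `s = g²` of an even `C^∞` function by `m!∕(2m)!` times the bound of its
`2m`-th derivative in g.  For `f(g) = g^{2m}` on `[0, γ]`: `∂^{2m}_g f ≡ (2m)!` and `f(√s) = s^m` with `∂^m_s ≡ m! = m!∕(2m)!·(2m)!` — the
inequality is an EQUALITY at every point of `[0, γ²]`, so the constant cannot be improved at any order (§2).  §1 computes the iterated
derivatives of monomials WITHIN a closed interval by P2 #43-A's assembly lemma (the tower `k ↦ n(n−1)⋯(n−k+1)·x^{n−k}`).  STATUS:
[folklore]; 0 def, 0 sorry; no Erice ∕ [I] sentence is used or asserted here; NOT continuum, NOT Clay.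

WHAT THIS FILE PROVES: `iteratedDerivWithin_pow_Icc` (monomials: `∂^k x^n = n.descFactorial k·x^{n−k}` within `[a, b]`, and `C^∞` there),
**`whitney_sharp`** (the equality case of P2 #43 `whitney_even` at every order m and every point).
-/

namespace Summit.QuantumFields.BalabanUV.Beta.EriceFlowEnclosureWhitneyWitness

open Filter Set Metric
open scoped Topology Nat
open Summit.QuantumFields.BalabanUV.Beta.EriceFlowEnclosureWhitneyCalc (contDiffOn_of_tower)

noncomputable section

/-! ## §1 Monomials within a closed interval -/

/-- **ITERATED DERIVATIVES OF A MONOMIAL WITHIN `[a, b]`** (`a < b`): `x ↦ x^n` is `C^m` on `[a, b]` for every m and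
`iteratedDerivWithin k (· ^ n) (Icc a b) x = n.descFactorial k·x^{n−k}` at every `x ∈ [a, b]` (for `k > n` both sides vanish) — the tower
`k ↦ n.descFactorial k·x^{n−k}` differentiates into itself (`Nat.descFactorial_succ`), assembled by P2 #43-A `contDiffOn_of_tower`.
[folklore] -/
theorem iteratedDerivWithin_pow_Icc {a b : ℝ} (hab : a < b) (n : ℕ) :
    (∀ m : ℕ, ContDiffOn ℝ m (fun x : ℝ => x ^ n) (Icc a b)) ∧
      ∀ k, ∀ x ∈ Icc a b, iteratedDerivWithin k (fun x : ℝ => x ^ n) (Icc a b) x = (n.descFactorial k : ℝ) * x ^ (n - k) := by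
  have htower : ∀ k, ∀ x ∈ Icc a b, HasDerivWithinAt (fun x : ℝ => (n.descFactorial k : ℝ) * x ^ (n - k))
      ((n.descFactorial (k + 1) : ℝ) * x ^ (n - (k + 1))) (Icc a b) x := by
    intro k x _
    have hp : HasDerivWithinAt (fun x : ℝ => x ^ (n - k)) (((n - k : ℕ) : ℝ) * x ^ (n - k - 1)) (Icc a b) x :=
      (hasDerivAt_pow (n - k) x).hasDerivWithinAt
    refine (hp.const_mul (n.descFactorial k : ℝ)).congr_deriv ?_
    rw [Nat.descFactorial_succ, Nat.sub_sub]
    push_cast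
    ring
  obtain ⟨hC, hD⟩ := contDiffOn_of_tower (H := fun k x => (n.descFactorial k : ℝ) * x ^ (n - k)) hab htower
  have hE : EqOn (fun x : ℝ => x ^ n) (fun x => (n.descFactorial 0 : ℝ) * x ^ (n - 0)) (Icc a b) := fun x _ => by simp
  refine ⟨fun m => (hC m).congr hE, fun k x hx => ?_⟩
  rw [iteratedDerivWithin_congr hE hx]
  exact hD k x hx

/-! ## §2 The equality case of Whitney's lemma -/

/-- **THE CONSTANT `m!∕(2m)!` OF `whitney_even` IS ATTAINED AT EVERY ORDER AND EVERY POINT.**  On `[0, γ]` (`0 < γ`) the even monomial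
`f(g) = g^{2m}` has `∂^{2m}_g f ≡ (2m)!` (so the best bound of its `2m`-th derivative is `M(2m) = (2m)!`), every odd derivative of it
vanishes at `g = 0`, and `f(√s) = s^m` on `[0, γ²]` with `∂^m_s (f ∘ √) ≡ m! = m!∕(2m)!·(2m)!`: P2 #43's inequality
`|∂^m_s (f ∘ √)| ≤ m!∕(2m)!·M(2m)` is an equality everywhere. [folklore] -/
theorem whitney_sharp {γ : ℝ} (hγ : 0 < γ) (m : ℕ) :
    (∀ g ∈ Icc (0 : ℝ) γ, iteratedDerivWithin (2 * m) (fun g : ℝ => g ^ (2 * m)) (Icc 0 γ) g = (2 * m) !) ∧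
      (∀ j, j % 2 = 1 → iteratedDerivWithin j (fun g : ℝ => g ^ (2 * m)) (Icc 0 γ) 0 = 0) ∧
      (∀ s ∈ Icc (0 : ℝ) (γ ^ 2),
        iteratedDerivWithin m (fun s => (Real.sqrt s) ^ (2 * m)) (Icc 0 (γ ^ 2)) s = (m ! : ℝ) / (2 * m) ! * (2 * m) !) := by
  have hγ2 : (0 : ℝ) < γ ^ 2 := by positivity
  obtain ⟨-, hDg⟩ := iteratedDerivWithin_pow_Icc hγ (2 * m)
  obtain ⟨-, hDs⟩ := iteratedDerivWithin_pow_Icc hγ2 m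
  refine ⟨fun g hg => ?_, fun j hj => ?_, fun s hs => ?_⟩
  · rw [hDg (2 * m) g hg, Nat.descFactorial_self, Nat.sub_self, pow_zero, mul_one]
  · rw [hDg j 0 ⟨le_rfl, hγ.le⟩]
    rcases le_or_gt j (2 * m) with hle | hlt
    · rw [zero_pow (by omega), mul_zero]
    · rw [Nat.descFactorial_eq_zero_iff_lt.mpr hlt, Nat.cast_zero, zero_mul]
  · have hE : EqOn (fun s => (Real.sqrt s) ^ (2 * m)) (fun s : ℝ => s ^ m) (Icc (0 : ℝ) (γ ^ 2)) := fun s hs => by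
      simp only [pow_mul, Real.sq_sqrt hs.1]
    rw [iteratedDerivWithin_congr hE hs, hDs m s hs, Nat.descFactorial_self, Nat.sub_self, pow_zero, mul_one]
    have h : ((2 * m) ! : ℝ) ≠ 0 := by positivity
    field_simp

end

end Summit.QuantumFields.BalabanUV.Beta.EriceFlowEnclosureWhitneyWitness
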